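import Summits.AnomalousDissipation.AnomalousDissipation.Theses.SteadyWeakLimit
import Summits.AnomalousDissipation.AnomalousDissipation.Theorems.SteadyWeakLimitProductionIdentity
import Literature.Analysis.FunctionSpaces.TorusCalculusProofs

/-!
Birth skeleton for piece A = `SteadyRealisationSubviscousForce`
(stmt-AnomalousDissipation-18056): line `strict-target-viscous-hprinciple`.

stub_strictTarget — an explicit smooth STRICT stationary Euler–Reynolds subsolution with source `f` and
  positive production (R symmetric positive definite pointwise ⟺ strictness; e.g. v₀ = sin(2πx₂)e₁,
  R₀ = βI − b cos(2πx₂)(e₁⊗e₂+e₂⊗e₁), β > b > 0, f = 2πb sin(2πx₂)e₁, production πb).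
stub_subviscousHPrinciple — the VISCOUS stationary h-principle at sub-viscous force defect: every smooth
  strict target (f, v, p, R) is the weak L² limit of bounded steady classical NS states with forces
  sub-viscously close to f (the open heart of A, universal over targets).
A_of — target + h-principle + the landed ProductionIdentity (∫⟪f,v⟫ = −∫R:∇v > 0) ⇒ A.
-/

namespace Summit.AnomalousDissipation.AnomalousDissipation.Cruxes.SteadyWeakRealisation.StrictTargetViscousHPrinciple

open MeasureTheory Filter Topology
open scoped InnerProductSpace ENNReal
open Literature.Analysis.FunctionSpaces Literature.Analysis.FunctionSpaces.Torus
open Summit.AnomalousDissipation.AnomalousDissipation.Theses.SteadyWeakLimit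

/-- STUB 1 (elementary, M): an explicit smooth STRICT stationary Euler–Reynolds target exists — `f, v, p, R`
smooth, `f` div-free mean-zero, `v` div-free, `R` symmetric and positive definite at every point (⟺ strictness:
with `e := |v|² + tr R`, `ů := v ⊗ v + R − (e/3) I` is traceless and `(e/3) I − (v ⊗ v − ů) = R > 0`),
`(v·∇)v + ∇p + div R = f` pointwise and positive production `0 < -∫ ∑ⱼ ⟪R eⱼ, ∂ⱼ v⟫`; witness (shear `v₀ = sin(2πx₂)e₁`,
`R₀ = βI − b cos(2πx₂)(e₁⊗e₂+e₂⊗e₁)`, `β > b > 0`, `f = 2πb sin(2πx₂) e₁`, `p = 0`, production `πb`). -/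
theorem stub_strictTarget :
    ∃ (f v : UnitAddTorus (Fin 3) → EuclideanSpace ℝ (Fin 3)) (p : UnitAddTorus (Fin 3) → ℝ)
      (R : UnitAddTorus (Fin 3) → Fin 3 → EuclideanSpace ℝ (Fin 3)),
      (IsSmooth f ∧ IsDivFree f ∧ HasZeroMean f ∧ IsSmooth v ∧ IsDivFree v ∧ IsSmooth p ∧ IsSmooth R ∧
        (∀ x (i j : Fin 3), R x i j = R x j i) ∧
        (∀ x (ξ : EuclideanSpace ℝ (Fin 3)), ξ ≠ 0 → 0 < ∑ i, ∑ j, ξ i * ξ j * R x j i) ∧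
        (∀ x, convect v v x + gradient p x + Literature.Analysis.FluidPDE.Torus.tensorDivergence R x = f x) ∧
        0 < -∫ x, ∑ j, ⟪R x j, partialDeriv j v x⟫_ℝ) := by
  sorry

/-- STUB 2 (the open heart, XL): VISCOUS stationary h-principle at SUB-VISCOUS force defect — every smooth
strict target is the weak `L²` limit of a bounded-energy family of steady classical `NS_{ν j}(fs j)`
states, `ν j → 0+`, with steady smooth div-free mean-zero forces `‖fs j - f‖_{L²} ≤ δ j · ν j`,
`δ j → 0`. -/
theorem stub_subviscousHPrinciple :
    ∀ (f v : UnitAddTorus (Fin 3) → EuclideanSpace ℝ (Fin 3)) (p : UnitAddTorus (Fin 3) → ℝ)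
      (R : UnitAddTorus (Fin 3) → Fin 3 → EuclideanSpace ℝ (Fin 3)),
      (IsSmooth f ∧ IsDivFree f ∧ HasZeroMean f ∧ IsSmooth v ∧ IsDivFree v ∧ IsSmooth p ∧ IsSmooth R ∧
        (∀ x (i j : Fin 3), R x i j = R x j i) ∧
        (∀ x (ξ : EuclideanSpace ℝ (Fin 3)), ξ ≠ 0 → 0 < ∑ i, ∑ j, ξ i * ξ j * R x j i) ∧
        (∀ x, convect v v x + gradient p x + Literature.Analysis.FluidPDE.Torus.tensorDivergence R x = f x) ∧
        0 < -∫ x, ∑ j, ⟪R x j, partialDeriv j v x⟫_ℝ) →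
      ∃ (ν δ : ℕ → ℝ) (fs u : ℕ → UnitAddTorus (Fin 3) → EuclideanSpace ℝ (Fin 3))
        (ps : ℕ → UnitAddTorus (Fin 3) → ℝ),
        (∀ j, 0 < ν j) ∧ Tendsto ν atTop (𝓝 0) ∧
        (∀ j, IsSmooth (fs j) ∧ IsDivFree (fs j) ∧ HasZeroMean (fs j)) ∧ Tendsto δ atTop (𝓝 0) ∧
        (∀ j, eLpNorm (fs j - f) 2 volume ≤ ENNReal.ofReal (δ j * ν j)) ∧
        (∀ j, IsClassicalNSSolutionOn Set.univ (ν j) (fun _ => fs j) (fun _ => u j) (fun _ => ps j)) ∧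
        (∃ E : ℝ, ∀ j, ∫ x, ‖u j x‖ ^ 2 ≤ E) ∧
        ∀ w : UnitAddTorus (Fin 3) → EuclideanSpace ℝ (Fin 3), IsSmooth w →
          Tendsto (fun j => ∫ x, ⟪w x, u j x⟫_ℝ) atTop (𝓝 (∫ x, ⟪w x, v x⟫_ℝ)) := by
  sorry

/-- COMPOSITION (kernel-checked, no sorry of its own; uses the two stubs by name): strict target +
viscous h-principle ⇒ A; the positivity of the injection is the production of the target through the
landed `ProductionIdentity` (`∫ ⟪f, v⟫ = -∫ ∑ⱼ ⟪R eⱼ, ∂ⱼ v⟫`). -/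
theorem SteadyRealisationSubviscousForce_of :
    Summit.AnomalousDissipation.AnomalousDissipation.Theses.SteadyWeakLimit.SteadyRealisationSubviscousForce := by
  unfold SteadyRealisationSubviscousForce
  obtain ⟨f, v, p, R, hT⟩ := stub_strictTarget
  obtain ⟨ν, δ, fs, u, ps, hν, hν0, hfs, hδ, hdef, hNS, hE, hweak⟩ := stub_subviscousHPrinciple f v p R hT
  obtain ⟨hf, hdf, hmf, hv, hdv, hp, hR, _hsymm, _hpd, heq, hprod⟩ := hT
  -- injection = production (landed support ProductionIdentity of the route)
  have hid : ∫ x, ⟪f x, v x⟫_ℝ = -∫ x, ∑ j, ⟪R x j, partialDeriv j v x⟫_ℝ :=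
    Summit.AnomalousDissipation.AnomalousDissipation.Theorems.productionIdentity_proof
      v f p R hv hf hp hR hdv heq
  refine ⟨f, v, ν, δ, fs, u, ps, hf, hdf, hmf, hν, hν0, hfs, hδ, hdef, hNS, hE, hv.memLp 2, hweak, ?_⟩
  rw [hid]
  exact hprod

end Summit.AnomalousDissipation.AnomalousDissipation.Cruxes.SteadyWeakRealisation.StrictTargetViscousHPrinciple
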